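import Mathlib

/-!
# Crux `TateFamilyKernel` (stmt-KontsevichZagierPeriods-9130), line `Sketch` — `stub_hermiteReduce`
# (wave 14, pure algebra: Hermite reduction with respect to a square-free denominator)

Over a field `K` of characteristic zero, let `D ∈ K[X]` be non-constant and coprime to its
derivative `D'`. Then for every `k : ℕ` and every `A ∈ K[X]` there are `M, R ∈ K[X]` with
`deg R < deg D` and

  `A = M'·D − k·(M·D') + R·D^k`,

i.e. `A/D^{k+1} = (M/D^k)' + R/D` (Hermite reduction, cleared of denominators).

Proof by induction on `k` (generalising `A`):
* `k = 0`: division with remainder `A = (A / D)·D + A % D` (`EuclideanDomain.div_add_mod'`,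
  `Polynomial.natDegree_mod_lt`) and a polynomial primitive `M` of `A / D`
  (`HermiteReduce.exists_derivative_eq`, needs characteristic zero);
* `k → k + 1`: from a Bezout relation `u·D + v·D' = 1` put `M₀ := −(k+1)⁻¹·A·v`, so that
  `A + (k+1)·M₀·D' = A·u·D`; apply the induction hypothesis to `A₁ := A·u − M₀'` and set
  `M := M₀ + M₁·D`; the identity is a ring computation (`linear_combination`).

Mathlib only; no named fact, no new definition. The helper lives in the sub-namespace
`HermiteReduce`. [folklore: Hermite 1872]
-/

noncomputable section

open MeasureTheory Set MvPolynomial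

namespace Summit.KontsevichZagierPeriods.InverseLandau.TateFamilyKernel.Descent

namespace HermiteReduce

/-- Every polynomial over a field of characteristic zero has a polynomial primitive:
`∫ a·Xⁿ = a/(n+1)·Xⁿ⁺¹`. [folklore] -/
theorem exists_derivative_eq {K : Type*} [Field K] [CharZero K] (Q : Polynomial K) :
    ∃ P : Polynomial K, Polynomial.derivative P = Q := by
  induction Q using Polynomial.induction_on' with
  | add p q hp hq =>
      obtain ⟨P, hP⟩ := hp
      obtain ⟨R, hR⟩ := hq
      exact ⟨P + R, by rw [Polynomial.derivative_add, hP, hR]⟩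
  | monomial n a =>
      refine ⟨Polynomial.monomial (n + 1) (a / (n + 1)), ?_⟩
      rw [Polynomial.derivative_monomial]
      have hn : ((n : K) + 1) ≠ 0 := by exact_mod_cast Nat.succ_ne_zero n
      simp only [Nat.add_sub_cancel, Nat.cast_add, Nat.cast_one]
      congr 1
      field_simp

end HermiteReduce

/-- **Hermite reduction with respect to a square-free denominator.** Over a field of
characteristic zero, if `D` is coprime to `D'` and non-constant, then for every `k` and `A` there
are `M, R` with `deg R < deg D` and `A = M'·D − k·M·D' + R·D^k`, i.e.
`A/D^{k+1} = (M/D^k)' + R/D`. (Induction on `k`: `k = 0` is division with remainder plus a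
polynomial primitive; the step solves `A + (k+1)M₀D' ≡ 0 (mod D)` by Bezout and applies the
induction hypothesis to `(A + (k+1)M₀D' − M₀'D)/D`, `M = M₀ + M₁D`.) [folklore: Hermite 1872] -/
theorem stub_hermiteReduce {K : Type*} [Field K] [CharZero K] (D : Polynomial K)
    (hD : IsCoprime D (Polynomial.derivative D)) (hdeg : 0 < D.natDegree) (k : ℕ) (A : Polynomial K) :
    ∃ M R : Polynomial K, R.natDegree < D.natDegree ∧
      A = Polynomial.derivative M * D - Polynomial.C (k : K) * (M * Polynomial.derivative D) + R * D ^ k := by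
  induction k generalizing A with
  | zero =>
      -- division with remainder and a primitive of the quotient
      obtain ⟨M, hM⟩ := HermiteReduce.exists_derivative_eq (A / D)
      refine ⟨M, A % D, Polynomial.natDegree_mod_lt A hdeg.ne', ?_⟩
      rw [hM, Nat.cast_zero, map_zero, zero_mul, sub_zero, pow_zero, mul_one]
      exact (EuclideanDomain.div_add_mod' A D).symm
  | succ k ih =>
      -- Bezout: `u·D + v·D' = 1`
      obtain ⟨u, v, huv⟩ := hD
      have hc : ((k + 1 : ℕ) : K) ≠ 0 := by exact_mod_cast Nat.succ_ne_zero k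
      have hcinv : Polynomial.C ((k + 1 : ℕ) : K) * Polynomial.C (((k + 1 : ℕ) : K)⁻¹) = 1 := by
        rw [← map_mul, mul_inv_cancel₀ hc, map_one]
      have hck : Polynomial.C ((k + 1 : ℕ) : K) = Polynomial.C (k : K) + 1 := by
        rw [Nat.cast_succ, map_add, map_one]
      -- `M₀ := −(k+1)⁻¹·A·v`, kept opaque so that `M₀'` stays symbolic
      obtain ⟨M₀, hM₀⟩ : ∃ M₀ : Polynomial K,
          M₀ = -(Polynomial.C (((k + 1 : ℕ) : K)⁻¹) * (A * v)) := ⟨_, rfl⟩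
      -- induction hypothesis applied to `A₁ := A·u − M₀'` (so that `A − M₀'D + (k+1)M₀D' = D·A₁`)
      obtain ⟨M₁, R, hR, hIH⟩ := ih (A * u - Polynomial.derivative M₀)
      refine ⟨M₀ + M₁ * D, R, hR, ?_⟩
      rw [Polynomial.derivative_add, Polynomial.derivative_mul]
      linear_combination D * hIH + M₁ * D * Polynomial.derivative D * hck
        + Polynomial.C ((k + 1 : ℕ) : K) * Polynomial.derivative D * hM₀
        - A * v * Polynomial.derivative D * hcinv - A * huv

end Summit.KontsevichZagierPeriods.InverseLandau.TateFamilyKernel.Descent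

end
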